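import Summits.BirchSwinnertonDyer.Rank1Residual.X11b.BDPRouteTwistCertificate
import HarnessLib

/-!
# Class X11b, route p2: STATEMENTS OF RECORD with twist certificates — the exceptional conjecture
# on the (T2∗) residue shrinks to its peu-ramifié part (cell `b2b-bsdres`, sub-cell `multr1-p2`, gen 22)

HONEST FRAMING (cell `b2b-bsdres`, run/shared/lean/b2b/bsd-rank1-residual/, verbatim in every
file): the goal of the cell is to DELETE the COMBINATION-SHAPED residual classes of the
Birch–Swinnerton-Dyer formula for ALL analytic-rank `≤ 1` elliptic curves over `ℚ` — "full BSD
formula for every rank `≤ 1` curve in class `C`" assembled STRICTLY from published theorems — so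
that the rank-`≤ 1` remainder becomes exactly the CONSTRUCTION-SHAPED classes, which are TYPED
(missing-input `Prop`s), NOT attempted. This is not "finishing BSD". Sub-cell `multr1-p2` is a
RESEARCH ROUTE on class X11b (`ClassX11b W p := r_an = 1 ∧ p ≠ 2 ∧ mult(p) ∧ irr(p)`,
`Partition/Rows.lean`); no claim beyond the stated class and loci; X11b's label does not change;
NOTHING is booked by this file.

THEOREMS ONLY (no definition, no named fact, no `sorry`). Companion of
`X11b/BDPRouteTwistCertificate.lean` (gen 22): there the Euler-system half on an X11b pair with
`p ≥ 5`, `ρ̄` onto and `p ∤ ∏_ℓ c_ℓ(E)` follows from PUBLISHED facts and ONE rational certificate —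
a Heegner field `K` (`d_K < -4`), a globally minimal model `Wd` of `E^{d_K}`, and the twist's
algebraic central value `q_d = L(E^{d_K},1)/Ω(Wd) ≠ 0` with `ord_p q_d = 0`
(`missingUpperBoundAt_of_classX11b_of_twistUnit`). Here the two gen-21 records
(`P2.bsdp_of_onTree_cyclotomic_exceptional`, `bsdp_of_classX11b_five_twoRoads_exceptional`) are
re-assembled with the lane's conjecture `ClassClosure.RelativeExceptionalLeadingTermAt` (Disegni's
split display WITHOUT his second multiplicative prime (∗)) demanded ONLY on the split-only pairs with
`p ∣ ∏c` — at a split `p` with no other multiplicative prime and no (ram) this means `p ∣ ord_p Δ_min`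
(peu ramifié): 334 ‖ 35 of the 55 089 ‖ 3 326 class-wide (T2∗) pairs (`N < 5·10⁵ ‖ N < 2·10⁴`,
multr1-p1 `census500k`, recount `census22/` in the seat dir) — and ONE twist certificate per pair
on the other 54 755 ‖ 3 291. The certificate input is stated INLINE as an existential over the
Heegner field and the twist model (no definition is introduced); its existence at every such pair
is NOT a published theorem (it is a per-pair computation: exact modular-symbol value of a twist),
so the class stays CONSTRUCTION-SHAPED and the records stay CONDITIONAL. Labels UNCHANGED.

References: [McCallumLMS1991] §1 Theorem (Kolyvagin), p. 296; [JetchevSkinnerWan2017] §7.4.1;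
[Disegni2020] Thm. 1 (§1.2), Thm. 4 (§3.2), (∗); [Skinner2016PacificMC] Thm. A; [Wuthrich2014]
Thm. 3, Prop. 21; [SteinWuthrich2013] Thm. 6.1, §4.2; [Castella2018Erratum] (2.4);
[SilvermanATAEC1994] Cor. IV.9.2; [Miller2011LMS] Def. 1.1.
-/

noncomputable section

open scoped Classical NumberField

open WeierstrassCurve NumberField IsDedekindDomain Field
open Literature.NumberTheory.EllipticCurves Literature.NumberTheory.EllipticCurves.GreenbergSelmer
  Literature.NumberTheory.EllipticCurves.ModularForms
  Literature.NumberTheory.EllipticCurves.Rank1Residual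
  Literature.NumberTheory.EllipticCurves.Rank1Residual.Typed
  Literature.NumberTheory.EllipticCurves.Wuthrich2014
  Literature.NumberTheory.EllipticCurves.SteinWuthrich2013
  Literature.NumberTheory.EllipticCurves.Disegni2020
  Literature.NumberTheory.EllipticCurves.Skinner2016
  Literature.NumberTheory.EllipticCurves.BalakrishnanEtAl2019
  Literature.NumberTheory.EllipticCurves.KrizLi2019
  Literature.NumberTheory.QuadraticFields.Quadratic
  Literature.NumberTheory.Automorphic
  Literature.NumberTheory.GaloisRepresentations Literature.NumberTheory.GaloisCohomology

namespace Summit.BirchSwinnertonDyer.Rank1Residual.X11b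

/-! ### Records: the conjecture on (T2∗) shrinks to its peu-ramifié part -/

/-- **Route p2 — STATEMENT OF RECORD with twist certificates (gen 22).** `∀ (E, p) ∈` X11b,
`p ≥ 5 → BSD(E, p)` from route p2's and the lever's published named facts (+ Kolyvagin 1990 Thm. A,
`hB`) and the typed inputs: (T1) THE open input `P2OpenInputOnTreeAt` [UNREFEREED: erratum (2.4) ⇐
FW21 4.41]; (REG) `ClassClosure.RegulatorNonvanishingAt` per pair [certificate / Schneider]; (TC)
on the pairs SPLIT at `p` with NO second multiplicative prime and `p ∤ ∏c` (54 755 ‖ 3 291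
class-wide ‖ `N < 2·10⁴`, all ¬(ram)): ONE twist certificate per pair — an imaginary quadratic
Heegner field `K` (`d_K < -4`), a globally minimal model `Wd` of `E^{d_K}` and its algebraic central
value `q_d ≠ 0` with `ord_p q_d = 0` [a rational number; EXISTENCE for every such pair is not a
published theorem]; (T2∗′) the conjecture `ClassClosure.RelativeExceptionalLeadingTermAt` ONLY on
split-only pairs with `p ∣ ∏c` (= `p ∣ ord_p Δ_min`: 334 ‖ 35); (T4′) the corner (64 ‖ 5). Gen
21's `P2.bsdp_of_onTree_cyclotomic_exceptional` with its conjecture binder restricted from 55 117 to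
334 class-wide pairs. CONDITIONAL; nothing booked; labels UNCHANGED; X11b stays CONSTRUCTION-SHAPED.
[cite: McCallumLMS1991, §1 Theorem (Kolyvagin), p. 296] [cite: Disegni2020, Thm. 1 (§1.2), Thm. 4, (∗)]
[cite: Wuthrich2014, Thm. 3 (p. 383), Prop. 21 (p. 400)] [cite: SteinWuthrich2013, Thm. 6.1, §4.2]
[cite: Castella2018, Thm. 2.3, Thm. 3.2] [cite: Castella2018Erratum, (2.4)] [cite: Miller2011LMS, Def. 1.1] -/
theorem P2.bsdp_of_onTree_cyclotomic_twistCertificate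
    -- route p2's published inputs
    (hGZ : ∀ (N : ℕ) [NeZero N] (W : WeierstrassCurve ℚ) (K : Type) [Field K] [NumberField K],
      gross_zagier N W K)
    (hKo : ∀ (N : ℕ) [NeZero N] (W : WeierstrassCurve ℚ) (K : Type) [Field K] [NumberField K],
      kolyvagin N W K)
    (hB : ∀ (N : ℕ) [NeZero N] (W : WeierstrassCurve ℚ) (K : Type) [Field K] [NumberField K],
      Kolyvagin1990_padicValNat_card_sha_le N W K)
    (hWu : sha_dvd_analyticSha)
    (hGZK : rank_eq_analyticRank_of_analyticRank_le_one) (hmod : hasEntireLFunction_rat)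
    (hnf : exists_isNewformOf) (hHL : HoffsteinLuo1997_exists_twist_L_one_ne_zero)
    (hMaz : mazur_not_dvd_maninConstant_of_odd)
    (hBDMTV : thm12_not_le_normalizer_splitCartan)
    (hPT : ∀ (K : Type) [Field K] [NumberField K], poitouTate_sum_localTatePairing_eq_zero K)
    (hEP : ∀ (K : Type) [Field K] [NumberField K] (v : HeightOneSpectrum (𝓞 K)),
      localEulerPoincareCharacteristic (v.adicCompletion K))
    -- the lever's published inputs
    (hK : kato_charIdeal_dvd_multiplicative_of_surjective)
    (hJn : thm61_nonsplitMultiplicative) (hJs : thm61_splitMultiplicative)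
    (hHn : exists_isMultCanonical) (hHs : exists_isSplitMultCanonical)
    (hD : thm1_padicBSD_rankOne_multiplicative) (hpar : nonempty_modularParametrizationData)
    -- (T1) THE open input
    (hA : ∀ (W : WeierstrassCurve ℚ) [W.IsElliptic] [W.IsGloballyMinimal] (p : ℕ) [Fact p.Prime],
      P2OpenInputOnTreeAt W p)
    -- (REG)
    (hReg : ∀ (W : WeierstrassCurve ℚ) [W.IsElliptic] [W.IsGloballyMinimal] (p : ℕ) [Fact p.Prime],
      ClassX11b W p → 5 ≤ p → ClassClosure.RegulatorNonvanishingAt W p)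
    -- (TC) ONE twist certificate per split-only pair with `p ∤ ∏c`
    (hTC : ∀ (W : WeierstrassCurve ℚ) [W.IsElliptic] [W.IsGloballyMinimal] (p : ℕ) [Fact p.Prime],
      ClassX11b W p → 5 ≤ p → W.HasSplitMultiplicativeReductionAtPrime p →
      (¬ ∃ (m : ℕ) (_ : Fact m.Prime), m ≠ p ∧ W.HasMultiplicativeReductionAtPrime m) →
      ¬ p ∣ W.tamagawaProduct →
      ∃ (K : Type) (_ : Field K) (_ : NumberField K) (Wd : WeierstrassCurve ℚ) (_ : Wd.IsElliptic)
        (_ : Wd.IsGloballyMinimal) (Cd : VariableChange ℚ) (qd : ℚ),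
        IsImaginaryQuadratic K ∧ SatisfiesHeegnerHypothesis (W.conductorNorm ℤ) K ∧
        NumberField.discr K < -4 ∧ Cd • W.quadraticTwist (NumberField.discr K : ℚ) = Wd ∧
        Wd.entireLFunction 1 / (Wd.realPeriodRat : ℂ) = (qd : ℂ) ∧ qd ≠ 0 ∧ padicValRat p qd = 0)
    -- (T2∗′) the exceptional conjecture, only on split-only pairs with `p ∣ ∏c`
    (hC : ∀ (W : WeierstrassCurve ℚ) [W.IsElliptic] [W.IsGloballyMinimal] (p : ℕ) [Fact p.Prime],
      ClassX11b W p → 5 ≤ p → W.HasSplitMultiplicativeReductionAtPrime p →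
      (¬ ∃ (m : ℕ) (_ : Fact m.Prime), m ≠ p ∧ W.HasMultiplicativeReductionAtPrime m) →
      p ∣ W.tamagawaProduct → ClassClosure.RelativeExceptionalLeadingTermAt W p)
    -- (T4′)
    (hCorner : ∀ (W : WeierstrassCurve ℚ) [W.IsElliptic] [W.IsGloballyMinimal] (p : ℕ)
      [Fact p.Prime], ClassX11b W p → ¬ Surj W p → (p = 5 ∨ p = 7) →
        p ∣ padicValInt p W.minimalDiscriminantInt → ¬ Ram W p → Typed.MissingPPartAt W p)
    (W : WeierstrassCurve ℚ) [W.IsElliptic] [W.IsGloballyMinimal] (p : ℕ) [Fact p.Prime]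
    (hX : ClassX11b W p) (hp5 : 5 ≤ p) : BSDp W p := by
  refine P2.bsdp_of_onTree_cyclotomic hGZ hKo hWu hGZK hmod hnf hHL hMaz hBDMTV hPT hEP hK hJn hJs hHn
    hHs hD hpar hA hReg ?_ hCorner W p hX hp5
  intro W _ _ p _ hX hp5 hsplit hm
  have hp2 : p ≠ 2 := hX.2.1
  by_cases hsurj : Surj W p
  · by_cases htam : p ∣ W.tamagawaProduct
    · exact missingUpperBoundAt_of_katoSurj_split_of_relativeLeadingTerm W p hK hJs hHs hGZK hpar hp2
        hX.2.2.1 hsplit hX.1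
        (kato_charIdeal_dvd_multiplicative_of_surjective.surjective_pow_of_five_le W p hp5 hsurj)
        (hC W p hX hp5 hsplit hm htam) (hReg W p hX hp5).2
    · obtain ⟨K, _, _, Wd, _, _, Cd, qd, hK', hHN, hdK, hWd, hqd, hqd0, hvd⟩ :=
        hTC W p hX hp5 hsplit hm htam
      exact missingUpperBoundAt_of_classX11b_of_twistUnit W p hGZ hKo hB hGZK hmod hnf hMaz hX hp5
        hsurj htam K hK' hHN hdK Wd Cd hWd qd hqd hqd0 hvd
  · -- non-surjective: the corner input gives the whole `p`-part, a fortiori the upper half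
    obtain ⟨h57, hdvd, hnram⟩ := ClassX11b.not_surj_shape W p hBDMTV hX hp5 hsurj
    exact (Typed.lower_and_upper_of_missingPPartAt W p (hCorner W p hX hsurj h57 hdvd hnram)).2

/-- **X11b at `p ≥ 5`, THE TWO ROADS with twist certificates (bookkeeping record).** `∀ (E, p) ∈`
X11b, `p ≥ 5 → BSD(E, p)` from published named facts (route p2's, the lever's, Skinner 2016 Thm. A,
Kolyvagin 1990 Thm. A) and: (REG) per pair everywhere; THE open input ONLY on ¬(ram) ∧ surj pairs
(112 175, 4.9 %); (TC) ONE twist certificate on ¬(ram) split-only pairs with `p ∤ ∏c` (54 755); the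
conjecture `RelativeExceptionalLeadingTermAt` ONLY on ¬(ram) split-only pairs with `p ∣ ∏c` (334);
(T4′) the corner (64). CONDITIONAL; nothing booked; labels UNCHANGED; X11b stays CONSTRUCTION-SHAPED.
[cite: Skinner2016PacificMC, Thm. A (§1)] [cite: McCallumLMS1991, §1 Theorem (Kolyvagin), p. 296]
[cite: Disegni2020, Thm. 1 (§1.2), (∗)] [cite: Castella2018Erratum, (2.4)] [cite: Miller2011LMS, Def. 1.1] -/
theorem bsdp_of_classX11b_five_twoRoads_twistCertificate
    (hGZ : ∀ (N : ℕ) [NeZero N] (W : WeierstrassCurve ℚ) (K : Type) [Field K] [NumberField K],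
      gross_zagier N W K)
    (hKo : ∀ (N : ℕ) [NeZero N] (W : WeierstrassCurve ℚ) (K : Type) [Field K] [NumberField K],
      kolyvagin N W K)
    (hB : ∀ (N : ℕ) [NeZero N] (W : WeierstrassCurve ℚ) (K : Type) [Field K] [NumberField K],
      Kolyvagin1990_padicValNat_card_sha_le N W K)
    (hWu : sha_dvd_analyticSha)
    (hGZK : rank_eq_analyticRank_of_analyticRank_le_one) (hmod : hasEntireLFunction_rat)
    (hnf : exists_isNewformOf) (hHL : HoffsteinLuo1997_exists_twist_L_one_ne_zero)
    (hMaz : mazur_not_dvd_maninConstant_of_odd)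
    (hBDMTV : thm12_not_le_normalizer_splitCartan)
    (hPT : ∀ (K : Type) [Field K] [NumberField K], poitouTate_sum_localTatePairing_eq_zero K)
    (hEP : ∀ (K : Type) [Field K] [NumberField K] (v : HeightOneSpectrum (𝓞 K)),
      localEulerPoincareCharacteristic (v.adicCompletion K))
    (hSkA : thmA_charIdeal_multiplicative)
    (hK : kato_charIdeal_dvd_multiplicative_of_surjective)
    (hJn : thm61_nonsplitMultiplicative) (hJs : thm61_splitMultiplicative)
    (hHn : exists_isMultCanonical) (hHs : exists_isSplitMultCanonical)
    (hD : thm1_padicBSD_rankOne_multiplicative) (hpar : nonempty_modularParametrizationData)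
    (hA : ∀ (W : WeierstrassCurve ℚ) [W.IsElliptic] [W.IsGloballyMinimal] (p : ℕ) [Fact p.Prime],
      ClassX11b W p → 5 ≤ p → ¬ Ram W p → Surj W p → P2OpenInputOnTreeAt W p)
    (hReg : ∀ (W : WeierstrassCurve ℚ) [W.IsElliptic] [W.IsGloballyMinimal] (p : ℕ) [Fact p.Prime],
      ClassX11b W p → 5 ≤ p → ClassClosure.RegulatorNonvanishingAt W p)
    (hTC : ∀ (W : WeierstrassCurve ℚ) [W.IsElliptic] [W.IsGloballyMinimal] (p : ℕ) [Fact p.Prime],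
      ClassX11b W p → 5 ≤ p → ¬ Ram W p → W.HasSplitMultiplicativeReductionAtPrime p →
      (¬ ∃ (m : ℕ) (_ : Fact m.Prime), m ≠ p ∧ W.HasMultiplicativeReductionAtPrime m) →
      ¬ p ∣ W.tamagawaProduct →
      ∃ (K : Type) (_ : Field K) (_ : NumberField K) (Wd : WeierstrassCurve ℚ) (_ : Wd.IsElliptic)
        (_ : Wd.IsGloballyMinimal) (Cd : VariableChange ℚ) (qd : ℚ),
        IsImaginaryQuadratic K ∧ SatisfiesHeegnerHypothesis (W.conductorNorm ℤ) K ∧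
        NumberField.discr K < -4 ∧ Cd • W.quadraticTwist (NumberField.discr K : ℚ) = Wd ∧
        Wd.entireLFunction 1 / (Wd.realPeriodRat : ℂ) = (qd : ℂ) ∧ qd ≠ 0 ∧ padicValRat p qd = 0)
    (hC : ∀ (W : WeierstrassCurve ℚ) [W.IsElliptic] [W.IsGloballyMinimal] (p : ℕ) [Fact p.Prime],
      ClassX11b W p → 5 ≤ p → ¬ Ram W p → W.HasSplitMultiplicativeReductionAtPrime p →
      (¬ ∃ (m : ℕ) (_ : Fact m.Prime), m ≠ p ∧ W.HasMultiplicativeReductionAtPrime m) →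
      p ∣ W.tamagawaProduct → ClassClosure.RelativeExceptionalLeadingTermAt W p)
    (hCorner : ∀ (W : WeierstrassCurve ℚ) [W.IsElliptic] [W.IsGloballyMinimal] (p : ℕ)
      [Fact p.Prime], ClassX11b W p → ¬ Surj W p → (p = 5 ∨ p = 7) →
        p ∣ padicValInt p W.minimalDiscriminantInt → ¬ Ram W p → Typed.MissingPPartAt W p)
    (W : WeierstrassCurve ℚ) [W.IsElliptic] [W.IsGloballyMinimal] (p : ℕ) [Fact p.Prime]
    (hX : ClassX11b W p) (hp5 : 5 ≤ p) : BSDp W p := by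
  refine bsdp_of_classX11b_five_twoRoads hGZ hKo hWu hGZK hmod hnf hHL hMaz hBDMTV hPT hEP hSkA hK hJn
    hJs hHn hHs hD hpar hA hReg ?_ hCorner W p hX hp5
  intro W _ _ p _ hX hp5 hnram hsplit hm
  by_cases hsurj : Surj W p
  · by_cases htam : p ∣ W.tamagawaProduct
    · exact missingUpperBoundAt_of_katoSurj_split_of_relativeLeadingTerm W p hK hJs hHs hGZK hpar
        hX.2.1 hX.2.2.1 hsplit hX.1
        (kato_charIdeal_dvd_multiplicative_of_surjective.surjective_pow_of_five_le W p hp5 hsurj)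
        (hC W p hX hp5 hnram hsplit hm htam) (hReg W p hX hp5).2
    · obtain ⟨K, _, _, Wd, _, _, Cd, qd, hK', hHN, hdK, hWd, hqd, hqd0, hvd⟩ :=
        hTC W p hX hp5 hnram hsplit hm htam
      exact missingUpperBoundAt_of_classX11b_of_twistUnit W p hGZ hKo hB hGZK hmod hnf hMaz hX hp5
        hsurj htam K hK' hHN hdK Wd Cd hWd qd hqd hqd0 hvd
  · obtain ⟨h57, hdvd, hnram'⟩ := ClassX11b.not_surj_shape W p hBDMTV hX hp5 hsurj
    exact (Typed.lower_and_upper_of_missingPPartAt W p (hCorner W p hX hsurj h57 hdvd hnram')).2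

end Summit.BirchSwinnertonDyer.Rank1Residual.X11b

end
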